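import Literature.Barriers.ValiantsHypothesis.BIJL18Thm4VerifierSemantics
import HarnessLib

/-!
# Bläser–Ikenmeyer–Jindal–Lysikov 2018, Thm 4 STRENGTHENED (equations of `C^{n,t,c}_r`): the
# `∃BPP` verifier's chart-test circuit with a CONSTANT slice-rank bound `c` — layout, semantics,
# soundness and completeness at the level of guessed blocks

Theorem-only companion of `BIJL18MatrixCompletion.lean` (typed fact `BIJL2018_thm4_strengthened K`,
ECCC TR18-064 p. 12, remark after Obs. 17: "There are infinite sequences `t_n = Θ(n)` and
`r_n = Θ(n)` and a constant `c` such that for every set of equations describing the variety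
`C^{n,t_n,c}_{r_n}`, at least one equation has superpolynomial circuit complexity, unless
`coNP ⊆ ∃BPP`") and the `c`-parametrised twin of `BIJL18Thm4VerifierSemantics.lean` (val-lit p7,
whose slice-rank profile is the vacuous `r_k = n`). Here the map `g` of Lemma 16 has the printed
rank profile `r₀ = r`, `r_k = c` with `c` an arbitrary parameter (`lemma16Poly K n m c r`), so that
"`p ∘ g = 0`" means "`p` vanishes on `C^{n,m,c}_r`" (`bijlVariety K n m c r`: border completion rank
`≤ r` AND every slice of rank `≤ c`, Obs. 17):

* §1–§2 the chart-test circuit `chartCircuitC n m c r B` (`U_k, V_k ∈ K^{c×n}`) of a guessed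
  Kabanets–Impagliazzo gate list `B` and its semantics `eval_chartCircuitC`;
* §3 the layout equivalence `layoutEquivC : Lemma16Params n m c r ≃ Fin (nVarC n m c r)` and
  `map_eval_chartCircuitC : map (chartCircuitC …).eval = rename layoutEquivC (p ∘ g)`,
  `eval_chartCircuitC_eq_zero_iff(_mem)`;
* §4 SOUNDNESS `lt_borderCompletionRank_of_testsC` — for an instance tensor WHOSE SLICES HAVE RANK
  `≤ c`, chart test `≡ 0` and evaluation `≢ 0` force `\underline{CR} > r`; COMPLETENESS from a typed
  natural proof (`exists_block_of_isBorderCRProofC`) and FROM A SET OF EQUATIONS of the variety all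
  of whose members have small constant-free circuits (`exists_block_of_equationsC`, the hypothesis
  shape of the strengthened statement);
* §5 the same over every infinite field / read modulo the characteristic (`_map`, `_zmod`).

Positions (`nPos`, `posEquiv`), the instance reading (`entryFn`, `tensorPoint_ofList`,
`tensorPoly`, `cast_eval_blockPoly`), the CNF padding and the characteristic bridges
(`map_intCast_eq_zero_iff_zmod`, `intCast_ne_zero_iff_zmod`) are REUSED BY NAME from the sibling;
the evaluation circuit is x5's `BILPS2019Cor42.evalCircuit`. Written for the `BIJL2018_thm4_strengthened`
roster (val-lit t23 g7: bounded-occurrence Max-2-SAT grading, machine, closers). Theorem-only file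
with plumbing `def`s; no statement of the barrier file is touched, no new fact. HONEST FRAMING
(val-lit): algebraic plumbing of a printed `∃BPP` verifier for a CONDITIONAL barrier about the
varieties `C^{n,t,c}_r`; nothing about `VP`; `VP ≠ VNP` is NOT proved.

## References

* [BlaserIkenmeyerJindalLysikov2018] M. Bläser, C. Ikenmeyer, G. Jindal, V. Lysikov, *Generalized
  matrix completion and algebraic natural proofs*, STOC 2018 / ECCC TR18-064: Thm 4 (proof,
  ECCC pp. 11–12), remark after Obs 17 (p. 12), Obs 15, Lemma 16, Obs 17.
* [KabanetsImpagliazzo2003] V. Kabanets, R. Impagliazzo, STOC 2003, proof of Cor. 12 (p. 358).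
* [Burgisser2000] P. Bürgisser, *Completeness and Reduction in Algebraic Complexity Theory*,
  Springer 2000, Def. 2.1, Rem. 2.7.
-/

noncomputable section

open MvPolynomial

namespace Literature.Barriers.ValiantsHypothesis

namespace BIJL2018Thm4

open Literature.Computability.AlgebraicComplexity ArithCircuit KIReduction BILPS2019Cor42

universe u

/-! ### §1. Layout of the Lemma-16 parameter variables with slice-rank bound `c` -/

section Layout

variable (n m c r : ℕ)

/-- Number of variables of the chart test: `U₀, V₀` (`r n` each), `U_k, V_k` (`m n²` each, slice
rank profile `r_k = n`), `z` (`m`). [cite: BlaserIkenmeyerJindalLysikov2018, Obs. 17 (the parameters of g)] -/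
def nVarC : ℕ := 2 * (r * n) + 2 * (m * (c * n)) + m

/-- Index of `(U_k)_{a i}`. [folklore] -/
def uIdxC (k a i : ℕ) : ℕ := 2 * (r * n) + ((k * c + a) * n + i)

/-- Index of `(V_k)_{a j}`. [folklore] -/
def vIdxC (k a j : ℕ) : ℕ := 2 * (r * n) + m * (c * n) + ((k * c + a) * n + j)

/-- Index of `z_k`. [folklore] -/
def zIdxC (k : ℕ) : ℕ := 2 * (r * n) + 2 * (m * (c * n)) + k

end Layout

/-! ### §2. The chart-test circuit "`p(g)`" with slice-rank bound `c` -/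

section Chart

variable (n m c r : ℕ)

/-- Product gate `(U₀)_{a i} (V₀)_{a j}` for input position `v` (`i = (v / n) % n`, `j = v % n`).
[cite: BlaserIkenmeyerJindalLysikov2018, Obs. 15 and Lemma 16] -/
def prodU0V0C (v a : ℕ) : Gate ℤ (Fin (nVarC n m c r)) :=
  .prod [varOp _ (u0Idx n a ((v / n) % n)), varOp _ (v0Idx n r a (v % n))]

/-- Product gate `z_k (U_k)_{a i} (V_k)_{a j}` for input position `v`, pair index `q = k n + a`.
[cite: BlaserIkenmeyerJindalLysikov2018, Lemma 16] -/
def prodZUVC (v q : ℕ) : Gate ℤ (Fin (nVarC n m c r)) :=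
  .prod [varOp _ (zIdxC n m c r (q / c)), varOp _ (uIdxC n c r (q / c) (q % c) ((v / n) % n)),
    varOp _ (vIdxC n m c r (q / c) (q % c) (v % n))]

/-- Product gate `(U_k)_{a i} (V_k)_{a j}` for input position `v` with `k = v / n² − 1` (the slice of
the position; junk but harmless on the constant slice). [cite: BlaserIkenmeyerJindalLysikov2018, Obs. 15] -/
def prodUVC (v a : ℕ) : Gate ℤ (Fin (nVarC n m c r)) :=
  .prod [varOp _ (uIdxC n c r (v / n ^ 2 - 1) a ((v / n) % n)), varOp _ (vIdxC n m c r (v / n ^ 2 - 1) a (v % n))]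

/-- The product gates of input position `v`: `r` of kind `U₀V₀`, `m n` of kind `zUV`, `n` of kind
`UV` (all value-independent). [cite: BlaserIkenmeyerJindalLysikov2018, Lemma 16] -/
def prodsC (v : ℕ) : List (Gate ℤ (Fin (nVarC n m c r))) :=
  (List.range r).map (prodU0V0C n m c r v) ++ (List.range (m * c)).map (prodZUVC n m c r v) ++
    (List.range c).map (prodUVC n m c r v)

/-- Length of the product gates. [cite: Burgisser2000, Def. 2.1] -/
@[simp] theorem length_prodsC (v : ℕ) : (prodsC n m c r v).length = r + m * c + c := by
  simp [prodsC, Nat.add_assoc]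

/-- The coordinate gate of input position `v`, its products sitting at `p, p + 1, …`: on the
constant slice (`v / n² = 0`) the entry `(U₀ᵀV₀ − Σ_k z_k U_kᵀV_k)_{ij}`, on slice `k+1` the entry
`(U_kᵀ V_k)_{ij}`. [cite: BlaserIkenmeyerJindalLysikov2018, Lemma 16 (the map g)] -/
def coordGateC (v p : ℕ) : Gate ℤ (Fin (nVarC n m c r)) :=
  if v / n ^ 2 = 0 then
    .sum ((List.range r).map (fun a => ((1 : ℤ), .gate (p + a))) ++
      (List.range (m * c)).map (fun q => ((-1 : ℤ), .gate (p + r + q))))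
  else .sum ((List.range c).map fun a => ((1 : ℤ), .gate (p + (r + m * c) + a)))

/-- The block of input position `v` placed at `p`: products then the coordinate gate.
[cite: BlaserIkenmeyerJindalLysikov2018, Lemma 16] -/
def coordBlockC (v p : ℕ) : List (Gate ℤ (Fin (nVarC n m c r))) :=
  prodsC n m c r v ++ [coordGateC n m c r v p]

/-- Length of one coordinate block. [cite: Burgisser2000, Def. 2.1] -/
def blockLenC : ℕ := r + m * c + c + 1

/-- Length of a coordinate block. [cite: Burgisser2000, Def. 2.1] -/
@[simp] theorem length_coordBlockC (v p : ℕ) : (coordBlockC n m c r v p).length = blockLenC m c r := by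
  simp [coordBlockC, blockLenC]

/-- All coordinate blocks (input positions `0, …, M−1`), starting at `base`.
[cite: BlaserIkenmeyerJindalLysikov2018, Lemma 16] -/
def coordsC (base M : ℕ) : List (Gate ℤ (Fin (nVarC n m c r))) :=
  (List.range M).flatMap fun v => coordBlockC n m c r v (base + v * blockLenC m c r)

/-- Length of the coordinate gates. [cite: Burgisser2000, Def. 2.1] -/
@[simp] theorem length_coordsC (base M : ℕ) : (coordsC n m c r base M).length = M * blockLenC m c r := by
  induction M with
  | zero => simp [coordsC]
  | succ M ih =>
    simp only [coordsC, List.range_succ, List.flatMap_append, List.flatMap_singleton, List.length_append,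
      length_coordBlockC] at ih ⊢
    rw [ih]; ring

/-- Position of the coordinate gate of input `v` among coordinates starting at `base`. [folklore] -/
def coordRefC (base v : ℕ) : ℕ := base + v * blockLenC m c r + (r + m * c + c)

/-- **The chart-test circuit** of the guessed block `B`: the coordinate blocks, a use of `B` behind
the coordinate gates, and a ballast of `nVarC` empty gates (so that the code word is at least as long
as the number of variables — the side condition of the tree's identity test on circuit codes).
[cite: BlaserIkenmeyerJindalLysikov2018, Thm. 4 (proof, step (2): "Decide whether p(g) = 0 using polynomial identity testing")] -/
def chartCircuitC (B : KBlock) : ArithCircuit ℤ (Fin (nVarC n m c r)) where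
  gates := coordsC n m c r 0 (nPos n m) ++
    useGatesRef (nPos n m * blockLenC m c r) (coordRefC m c r 0) (nPos n m) B ++
    ballast (nVarC n m c r) (nVarC n m c r)
  output := .gate (nPos n m * blockLenC m c r + useOut (nPos n m) B)

/-! #### Semantics of the chart-test circuit -/

/-- The polynomial of the coordinate at input position `v` (`h = v / n²`, `i = (v / n) % n`,
`j = v % n`): `Σ_{a<r} (U₀)_{ai}(V₀)_{aj} − Σ_{k<m} Σ_{a<n} z_k (U_k)_{ai} (V_k)_{aj}` if `h = 0`,
else `Σ_{a<n} (U_{h−1})_{ai} (V_{h−1})_{aj}`.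
[cite: BlaserIkenmeyerJindalLysikov2018, Lemma 16 (the map g)] -/
def coordPolyC (v : ℕ) : MvPolynomial (Fin (nVarC n m c r)) ℤ :=
  if v / n ^ 2 = 0 then
    (∑ a : Fin r, varP _ (u0Idx n a ((v / n) % n)) * varP _ (v0Idx n r a (v % n))) -
      ∑ k : Fin m, ∑ a : Fin c, varP _ (zIdxC n m c r k) *
        varP _ (uIdxC n c r k a ((v / n) % n)) * varP _ (vIdxC n m c r k a (v % n))
  else ∑ a : Fin c, varP _ (uIdxC n c r (v / n ^ 2 - 1) a ((v / n) % n)) *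
    varP _ (vIdxC n m c r (v / n ^ 2 - 1) a (v % n))

/-- The values of the product gates of input position `v`. [folklore] -/
def prodValsC (v : ℕ) : List (MvPolynomial (Fin (nVarC n m c r)) ℤ) :=
  (List.range r).map (fun a => varP _ (u0Idx n a ((v / n) % n)) * varP _ (v0Idx n r a (v % n))) ++
    (List.range (m * c)).map (fun q => varP _ (zIdxC n m c r (q / c)) *
      varP _ (uIdxC n c r (q / c) (q % c) ((v / n) % n)) * varP _ (vIdxC n m c r (q / c) (q % c) (v % n))) ++
    (List.range c).map (fun a => varP _ (uIdxC n c r (v / n ^ 2 - 1) a ((v / n) % n)) *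
      varP _ (vIdxC n m c r (v / n ^ 2 - 1) a (v % n)))

/-- Length of the product values. [cite: Burgisser2000, Def. 2.1] -/
@[simp] theorem length_prodValsC (v : ℕ) : (prodValsC n m c r v).length = r + m * c + c := by
  simp [prodValsC, Nat.add_assoc]

/-- The values of a coordinate block: the products and the coordinate. [folklore] -/
def coordBlockValsC (v : ℕ) : List (MvPolynomial (Fin (nVarC n m c r)) ℤ) :=
  prodValsC n m c r v ++ [coordPolyC n m c r v]

/-- Length of the values of a coordinate block. [cite: Burgisser2000, Def. 2.1] -/
@[simp] theorem length_coordBlockValsC (v : ℕ) : (coordBlockValsC n m c r v).length = blockLenC m c r := by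
  simp [coordBlockValsC, blockLenC]

/-- Appending value-independent gates appends their (fixed) values. [folklore] -/
private theorem gateValues_append_of_forall (pre gs : List (Gate ℤ (Fin (nVarC n m c r))))
    (f : Gate ℤ (Fin (nVarC n m c r)) → MvPolynomial (Fin (nVarC n m c r)) ℤ)
    (h : ∀ g ∈ gs, ∀ vals, g.eval vals = f g) : gateValues (pre ++ gs) = gateValues pre ++ gs.map f := by
  induction gs using List.reverseRecOn with
  | nil => simp
  | append_singleton gs g ih =>
    rw [← List.append_assoc, gateValues_append_singleton, ih (fun g' hg' => h g' (by simp [hg'])),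
      List.map_append, List.map_singleton, List.append_assoc, h g (by simp)]

/-- The product gates are value-independent and compute `prodValsC`. [folklore] -/
private theorem gateValues_append_prodsC (pre : List (Gate ℤ (Fin (nVarC n m c r)))) (v : ℕ) :
    gateValues (pre ++ prodsC n m c r v) = gateValues pre ++ prodValsC n m c r v := by
  rw [gateValues_append_of_forall n m c r pre _ (fun g => g.eval []) (fun g hg vals => ?_)]
  · simp [prodsC, prodValsC, prodU0V0C, prodZUVC, prodUVC, Gate.eval, Function.comp_def, mul_assoc]
  · simp only [prodsC, List.mem_append, List.mem_map, List.mem_range] at hg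
    rcases hg with (⟨a, -, rfl⟩ | ⟨q, -, rfl⟩) | ⟨a, -, rfl⟩ <;> simp [prodU0V0C, prodZUVC, prodUVC, Gate.eval]

/-- Reading position `V.length + j` of `V ++ W`. [folklore] -/
private theorem getD_append_right' (V W : List (MvPolynomial (Fin (nVarC n m c r)) ℤ)) (j : ℕ) :
    (V ++ W).getD (V.length + j) 0 = W.getD j 0 := by
  rw [List.getD_eq_getElem?_getD, List.getD_eq_getElem?_getD, List.getElem?_append_right (by omega),
    Nat.add_sub_cancel_left]

/-- A sum of list-indexed gate references over `range`, read as a `Finset` sum. [folklore] -/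
private theorem sum_map_range_smul_gate (vals : List (MvPolynomial (Fin (nVarC n m c r)) ℤ)) (co : ℤ)
    (f : ℕ → ℕ) (M : ℕ) :
    (((List.range M).map fun a => (co, (Operand.gate (f a) : Operand ℤ (Fin (nVarC n m c r))))).map
        (fun a => a.1 • a.2.eval vals)).sum = ∑ a ∈ Finset.range M, co • vals.getD (f a) 0 := by
  rw [List.map_map, ← List.toFinset_range, List.sum_toFinset _ List.nodup_range]
  rfl

/-- Sums over `q < m n` read as double sums over `(q / n, q % n)`. [folklore] -/
private theorem sum_fin_mul_eq_sum_sum {β : Type*} [AddCommMonoid β] (m n : ℕ) (G : ℕ → ℕ → β) :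
    ∑ q : Fin (m * n), G (q.1 / n) (q.1 % n) = ∑ k : Fin m, ∑ a : Fin n, G k a := by
  rw [← Equiv.sum_comp finProdFinEquiv (fun q : Fin (m * n) => G (q.1 / n) (q.1 % n)), Fintype.sum_prod_type]
  refine Finset.sum_congr rfl fun k _ => Finset.sum_congr rfl fun a _ => ?_
  have hn : 0 < n := Nat.pos_of_ne_zero fun h => by subst h; exact absurd a.isLt (Nat.not_lt_zero _)
  simp only [finProdFinEquiv_apply_val]
  rw [Nat.add_mul_div_left _ _ hn, Nat.div_eq_of_lt a.isLt, Nat.zero_add, Nat.add_mul_mod_self_left,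
    Nat.mod_eq_of_lt a.isLt]

/-- **The coordinate gate computes the coordinate polynomial** when its products sit right before
it. [cite: BlaserIkenmeyerJindalLysikov2018, Lemma 16 (the map g)] -/
theorem eval_coordGateC (V : List (MvPolynomial (Fin (nVarC n m c r)) ℤ)) (v : ℕ) :
    (coordGateC n m c r v V.length).eval (V ++ prodValsC n m c r v) = coordPolyC n m c r v := by
  have hget : ∀ j, (V ++ prodValsC n m c r v).getD (V.length + j) 0 = (prodValsC n m c r v).getD j 0 :=
    getD_append_right' n m c r V _
  have hA : ∀ a < r, (prodValsC n m c r v).getD a 0 =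
      varP _ (u0Idx n a ((v / n) % n)) * varP _ (v0Idx n r a (v % n)) := fun a ha => by
    rw [prodValsC, List.append_assoc, List.getD_eq_getElem?_getD, List.getElem?_append_left (by simpa using ha)]
    simp [List.getElem?_range ha]
  have hB : ∀ q < m * c, (prodValsC n m c r v).getD (r + q) 0 = varP _ (zIdxC n m c r (q / c)) *
      varP _ (uIdxC n c r (q / c) (q % c) ((v / n) % n)) * varP _ (vIdxC n m c r (q / c) (q % c) (v % n)) := fun q hq => by
    rw [prodValsC, List.append_assoc, List.getD_eq_getElem?_getD,
      List.getElem?_append_right (by simp), List.length_map, List.length_range, Nat.add_sub_cancel_left,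
      List.getElem?_append_left (by simpa using hq)]
    simp [List.getElem?_range hq]
  have hC : ∀ a < c, (prodValsC n m c r v).getD (r + m * c + a) 0 =
      varP _ (uIdxC n c r (v / n ^ 2 - 1) a ((v / n) % n)) * varP _ (vIdxC n m c r (v / n ^ 2 - 1) a (v % n)) := fun a ha => by
    rw [prodValsC, List.getD_eq_getElem?_getD, List.getElem?_append_right (by simp)]
    simp [List.getElem?_range ha]
  unfold coordGateC coordPolyC
  split_ifs with h
  · simp only [Gate.eval, List.map_append, List.sum_append]
    rw [sum_map_range_smul_gate, sum_map_range_smul_gate, sub_eq_add_neg, Finset.sum_range, Finset.sum_range,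
      ← sum_fin_mul_eq_sum_sum m c (fun k a => varP _ (zIdxC n m c r k) * varP _ (uIdxC n c r k a ((v / n) % n)) *
        varP _ (vIdxC n m c r k a (v % n))), ← Finset.sum_neg_distrib]
    congr 1
    · exact Finset.sum_congr rfl fun a _ => by rw [hget, hA a a.isLt, one_smul]
    · exact Finset.sum_congr rfl fun q _ => by
        rw [Nat.add_assoc, hget, hB q q.isLt, neg_one_zsmul]
  · simp only [Gate.eval]
    rw [sum_map_range_smul_gate, Finset.sum_range]
    exact Finset.sum_congr rfl fun a _ => by rw [Nat.add_assoc, hget, hC a a.isLt, one_smul]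

/-- **Values of a coordinate block** placed at its own position. [folklore] -/
private theorem gateValues_append_coordBlockC (pre : List (Gate ℤ (Fin (nVarC n m c r)))) (v : ℕ) :
    gateValues (pre ++ coordBlockC n m c r v pre.length) = gateValues pre ++ coordBlockValsC n m c r v := by
  rw [coordBlockC, ← List.append_assoc, gateValues_append_singleton, gateValues_append_prodsC, coordBlockValsC,
    List.append_assoc]
  have hlen : (gateValues pre).length = pre.length := gateValues_length pre
  congr 2
  have := eval_coordGateC n m c r (gateValues pre) v
  rw [hlen] at this
  rw [this]

/-- Unfolding `coordsC` by one input position. [cite: BlaserIkenmeyerJindalLysikov2018, Lemma 16] -/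
theorem coordsC_succ (base M : ℕ) :
    coordsC n m c r base (M + 1) = coordsC n m c r base M ++ coordBlockC n m c r M (base + M * blockLenC m c r) := by
  simp [coordsC, List.range_succ, List.flatMap_append]

/-- **Values of the coordinate gates** placed at their own position. [folklore] -/
private theorem gateValues_append_coordsC (pre : List (Gate ℤ (Fin (nVarC n m c r)))) (M : ℕ) :
    gateValues (pre ++ coordsC n m c r pre.length M) =
      gateValues pre ++ (List.range M).flatMap (coordBlockValsC n m c r) := by
  induction M with
  | zero => simp [coordsC]
  | succ M ih =>
    rw [coordsC_succ, ← List.append_assoc,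
      show pre.length + M * blockLenC m c r = (pre ++ coordsC n m c r pre.length M).length by simp,
      gateValues_append_coordBlockC, ih, List.range_succ, List.flatMap_append, List.flatMap_singleton,
      List.append_assoc]

/-- Reading inside a concatenation of blocks of constant length. [folklore] -/
private theorem getD_flatMap_range {α : Type*} (f : ℕ → List α) {L : ℕ} (hf : ∀ i, (f i).length = L) (d : α)
    {M i j : ℕ} (hi : i < M) (hj : j < L) :
    ((List.range M).flatMap f).getD (i * L + j) d = (f i).getD j d := by
  induction M with
  | zero => exact absurd hi (Nat.not_lt_zero _)
  | succ M ih =>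
    have hlen : ((List.range M).flatMap f).length = M * L := by
      clear hi ih
      induction M with
      | zero => simp
      | succ M ih => simp [List.range_succ, List.flatMap_append, ih, hf]; ring
    rw [List.range_succ, List.flatMap_append, List.flatMap_singleton, List.getD_eq_getElem?_getD,
      List.getD_eq_getElem?_getD]
    rcases Nat.lt_succ_iff_lt_or_eq.1 hi with h | rfl
    · rw [List.getElem?_append_left (by rw [hlen]; nlinarith), ← List.getD_eq_getElem?_getD,
        ← List.getD_eq_getElem?_getD, ih h]
    · rw [List.getElem?_append_right (by rw [hlen]; omega), hlen, Nat.add_sub_cancel_left]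

/-- **The coordinate gate of input `v` holds `coordPolyC v`.** [cite: BlaserIkenmeyerJindalLysikov2018, Lemma 16] -/
theorem valueAt_coordsC (pre post : List (Gate ℤ (Fin (nVarC n m c r)))) {M v : ℕ} (hv : v < M) :
    valueAt (pre ++ coordsC n m c r pre.length M ++ post) (coordRefC m c r pre.length v) = coordPolyC n m c r v := by
  have hlt : coordRefC m c r pre.length v < (pre ++ coordsC n m c r pre.length M).length := by
    simp only [coordRefC, List.length_append, length_coordsC]
    have : (v + 1) * blockLenC m c r ≤ M * blockLenC m c r := Nat.mul_le_mul_right _ hv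
    simp only [blockLenC] at this ⊢
    nlinarith
  rw [valueAt_append_left _ _ hlt, valueAt, gateValues_append_coordsC, coordRefC, Nat.add_assoc,
    List.getD_eq_getElem?_getD, List.getElem?_append_right (by rw [gateValues_length]; omega), gateValues_length,
    Nat.add_sub_cancel_left, ← List.getD_eq_getElem?_getD,
    getD_flatMap_range (coordBlockValsC n m c r) (L := blockLenC m c r) (length_coordBlockValsC n m c r) 0 hv
      (by simp [blockLenC])]
  simp [coordBlockValsC, List.getD_eq_getElem?_getD]

/-- **The chart-test circuit computes `blockPoly` at the coordinates of `g`.**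
[cite: BlaserIkenmeyerJindalLysikov2018, Thm. 4 (proof, step (2): "p(g)")] -/
theorem eval_chartCircuitC (B : KBlock) :
    (chartCircuitC n m c r B).eval =
      aeval (fun i : Fin (nPos n m) => coordPolyC n m c r i) (blockPoly (nPos n m) B) := by
  change (Operand.gate (nPos n m * blockLenC m c r + useOut (nPos n m) B) : Operand ℤ _).eval
    (gateValues (coordsC n m c r 0 (nPos n m) ++
      useGatesRef (nPos n m * blockLenC m c r) (coordRefC m c r 0) (nPos n m) B ++ ballast (nVarC n m c r) (nVarC n m c r))) = _
  rw [eval_gate_eq_valueAt]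
  have hpre : (coordsC n m c r 0 (nPos n m)).length = nPos n m * blockLenC m c r := by simp
  rw [← hpre, valueAt_useGatesRef _ _ (fun i hi => ?_) B]
  · have hfun : (fun i : Fin (nPos n m) => valueAt (coordsC n m c r 0 (nPos n m)) (coordRefC m c r 0 i.1)) =
        fun i : Fin (nPos n m) => coordPolyC n m c r i.1 := funext fun i => by
      have h := valueAt_coordsC n m c r [] [] (M := nPos n m) (v := i.1) i.isLt
      simpa using h
    rw [hfun]
  · simp only [coordRefC, length_coordsC]
    have : (i + 1) * blockLenC m c r ≤ nPos n m * blockLenC m c r := Nat.mul_le_mul_right _ hi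
    simp only [blockLenC] at this ⊢
    nlinarith

/-- Size of the chart-test circuit. [cite: Burgisser2000, Def. 2.1] -/
theorem size_chartCircuitC (B : KBlock) :
    (chartCircuitC n m c r B).size = nPos n m * blockLenC m c r + (nPos n m + B.length + 1) + nVarC n m c r := by
  simp only [chartCircuitC, size, ballast, List.length_append, length_coordsC, length_useGatesRef,
    List.length_replicate]

end Chart

/-! ### §3. Positions and parameters as `Fin` variables; the chart test against the map `g` of Lemma 16 -/

section Link

variable (n m c r : ℕ)

variable (K : Type u) [Field K]

/-- **The layout equivalence** of the Lemma-16 parameters (slice-rank profile `r_k = n`) with the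
chart-test variables: `(U₀)_{ai} ↦ a n + i`, `(V₀)_{aj} ↦ r n + a n + j`, `(U_k)_{ai} ↦ 2rn + k n² + a n + i`,
`(V_k)_{aj} ↦ 2rn + m n² + k n² + a n + j`, `z_k ↦ 2rn + 2mn² + k`.
[cite: BlaserIkenmeyerJindalLysikov2018, Obs. 17 (the parameters of g)] -/
def layoutEquivC : Lemma16Params n m c r ≃ Fin (nVarC n m c r) :=
  ((Equiv.sumCongr (Equiv.sumCongr finProdFinEquiv finProdFinEquiv)
      (Equiv.sumCongr
        (Equiv.sumCongr (((Equiv.prodCongr (Equiv.refl (Fin m)) finProdFinEquiv)).trans finProdFinEquiv)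
          (((Equiv.prodCongr (Equiv.refl (Fin m)) finProdFinEquiv)).trans finProdFinEquiv))
        (Equiv.refl (Fin m)))).trans
    ((Equiv.sumCongr finSumFinEquiv ((Equiv.sumCongr finSumFinEquiv (Equiv.refl _)).trans finSumFinEquiv)).trans
      finSumFinEquiv)).trans
    (finCongr (by unfold nVarC; ring))

/-- Layout of `(U₀)_{ai}`. [cite: BlaserIkenmeyerJindalLysikov2018, Obs. 17] -/
@[simp] theorem layoutEquivC_u0 (a : Fin r) (i : Fin n) :
    (layoutEquivC n m c r (Sum.inl (Sum.inl (a, i)))).1 = u0Idx n a i := by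
  simp [layoutEquivC, u0Idx]; ring

/-- Layout of `(V₀)_{aj}`. [cite: BlaserIkenmeyerJindalLysikov2018, Obs. 17] -/
@[simp] theorem layoutEquivC_v0 (a : Fin r) (j : Fin n) :
    (layoutEquivC n m c r (Sum.inl (Sum.inr (a, j)))).1 = v0Idx n r a j := by
  simp [layoutEquivC, v0Idx]; ring

/-- Layout of `(U_k)_{ai}`. [cite: BlaserIkenmeyerJindalLysikov2018, Obs. 17] -/
@[simp] theorem layoutEquivC_u (k : Fin m) (a : Fin c) (i : Fin n) :
    (layoutEquivC n m c r (Sum.inr (Sum.inl (Sum.inl (k, a, i))))).1 = uIdxC n c r k a i := by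
  simp [layoutEquivC, uIdxC]; ring

/-- Layout of `(V_k)_{aj}`. [cite: BlaserIkenmeyerJindalLysikov2018, Obs. 17] -/
@[simp] theorem layoutEquivC_v (k : Fin m) (a : Fin c) (j : Fin n) :
    (layoutEquivC n m c r (Sum.inr (Sum.inl (Sum.inr (k, a, j))))).1 = vIdxC n m c r k a j := by
  simp [layoutEquivC, vIdxC]; ring

/-- Layout of `z_k`. [cite: BlaserIkenmeyerJindalLysikov2018, Obs. 17] -/
@[simp] theorem layoutEquivC_z (k : Fin m) :
    (layoutEquivC n m c r (Sum.inr (Sum.inr k))).1 = zIdxC n m c r k := by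
  simp [layoutEquivC, zIdxC]; ring

variable {n m c r}

/-- `varP` at a laid-out parameter is the variable, over `K`. [cite: Burgisser2000, Def. 2.1] -/
private theorem map_varP_layoutC (q : Lemma16Params n m c r) :
    map (Int.castRingHom K) (varP (nVarC n m c r) (layoutEquivC n m c r q).1) = X (layoutEquivC n m c r q) := by
  rw [varP_of_lt (layoutEquivC n m c r q).isLt, map_X]

/-- **The coordinate polynomial of a position is the laid-out coordinate of `g`**:
`coordPolyC (posEquiv v) = rename layoutEquivC (lemma16Poly v)` (read over `K`).
[cite: BlaserIkenmeyerJindalLysikov2018, Lemma 16 and Obs. 17 (g as a polynomial map)] -/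
theorem map_coordPolyC_posEquiv (v : Option (Fin m) × Fin n × Fin n) :
    map (Int.castRingHom K) (coordPolyC n m c r (posEquiv n m v).1) =
      rename (layoutEquivC n m c r) (lemma16Poly K n m c r v) := by
  obtain ⟨hd, hbm, hcm⟩ := posEquiv_div_mod (n := n) (m := m) v
  obtain ⟨h, i, j⟩ := v
  simp only at hd hbm hcm
  have hu0 : ∀ a : Fin r, map (Int.castRingHom K) (varP (nVarC n m c r) (u0Idx n a i)) =
      X (layoutEquivC n m c r (Sum.inl (Sum.inl (a, i)))) := fun a => by
    rw [← map_varP_layoutC K, layoutEquivC_u0]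
  have hv0 : ∀ a : Fin r, map (Int.castRingHom K) (varP (nVarC n m c r) (v0Idx n r a j)) =
      X (layoutEquivC n m c r (Sum.inl (Sum.inr (a, j)))) := fun a => by
    rw [← map_varP_layoutC K, layoutEquivC_v0]
  have hu : ∀ (k : Fin m) (a : Fin c), map (Int.castRingHom K) (varP (nVarC n m c r) (uIdxC n c r k a i)) =
      X (layoutEquivC n m c r (Sum.inr (Sum.inl (Sum.inl (k, a, i))))) := fun k a => by
    rw [← map_varP_layoutC K, layoutEquivC_u]
  have hv : ∀ (k : Fin m) (a : Fin c), map (Int.castRingHom K) (varP (nVarC n m c r) (vIdxC n m c r k a j)) =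
      X (layoutEquivC n m c r (Sum.inr (Sum.inl (Sum.inr (k, a, j))))) := fun k a => by
    rw [← map_varP_layoutC K, layoutEquivC_v]
  have hz : ∀ k : Fin m, map (Int.castRingHom K) (varP (nVarC n m c r) (zIdxC n m c r k)) =
      X (layoutEquivC n m c r (Sum.inr (Sum.inr k))) := fun k => by
    rw [← map_varP_layoutC K, layoutEquivC_z]
  unfold coordPolyC
  rw [hd, hbm, hcm]
  cases h with
  | none =>
    rw [sliceIdx, if_pos rfl]
    simp only [map_sub, map_sum, map_mul, hu0, hv0, hu, hv, hz, lemma16Poly, rename_X, Finset.mul_sum, mul_assoc]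
  | some k =>
    rw [sliceIdx, if_neg (Nat.succ_ne_zero _), Nat.add_sub_cancel]
    simp only [map_sum, map_mul, hu, hv, lemma16Poly, rename_X]

/-- **The chart test over `K` is `p ∘ g` laid out**: `map (chartCircuitC B).eval =
rename layoutEquivC (p ∘ g)` with `p = tensorPoly B`.
[cite: BlaserIkenmeyerJindalLysikov2018, Thm. 4 (proof, step (2)) and Lemma 16] -/
theorem map_eval_chartCircuitC (B : KBlock) :
    map (Int.castRingHom K) (chartCircuitC n m c r B).eval =
      rename (layoutEquivC n m c r) (bind₁ (lemma16Poly K n m c r) (tensorPoly (n := n) (m := m) K B)) := by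
  rw [eval_chartCircuitC, aeval_eq_bind₁, map_bind₁, tensorPoly, rename_bind₁, bind₁_rename]
  have hfg : (fun i : Fin (nPos n m) => map (Int.castRingHom K) (coordPolyC n m c r i.1)) =
      ((fun i => rename (layoutEquivC n m c r) (lemma16Poly K n m c r i)) ∘ (posEquiv n m).symm) := by
    funext i
    simp only [Function.comp_apply]
    have h := map_coordPolyC_posEquiv (c := c) (r := r) K ((posEquiv n m).symm i)
    rwa [Equiv.apply_symm_apply] at h
  rw [hfg]

variable [CharZero K]

/-- **The chart-test circuit vanishes iff `p ∘ g = 0` as a polynomial over `K`** (characteristic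
`0`: the integer identity and the `K`-identity are equivalent). [cite: BlaserIkenmeyerJindalLysikov2018, Thm. 4 (proof, step (2): "Decide whether p(g) = 0 using polynomial identity testing")] -/
theorem eval_chartCircuitC_eq_zero_iff (B : KBlock) :
    (chartCircuitC n m c r B).eval = 0 ↔
      bind₁ (lemma16Poly K n m c r) (tensorPoly (n := n) (m := m) K B) = 0 := by
  constructor
  · intro h
    have h' := map_eval_chartCircuitC (n := n) (m := m) (c := c) (r := r) K B
    rw [h, map_zero] at h'
    exact rename_injective _ (layoutEquivC n m c r).injective (by rw [← h', map_zero])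
  · intro h
    apply map_injective (Int.castRingHom K) Int.cast_injective
    rw [map_eval_chartCircuitC, h, map_zero, map_zero]

/-- **The chart test vanishes iff the guessed polynomial vanishes on the image of `g`** (the
vanishing ideal of `C^{n,m,n}_r`, `K` infinite). [cite: BlaserIkenmeyerJindalLysikov2018, Lemma 16 and Obs. 17] -/
theorem eval_chartCircuitC_eq_zero_iff_mem (B : KBlock) :
    (chartCircuitC n m c r B).eval = 0 ↔ tensorPoly (n := n) (m := m) K B ∈ lemma16VanishingIdeal K n m c r := by
  haveI : Infinite K := Infinite.of_injective _ Nat.cast_injective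
  rw [eval_chartCircuitC_eq_zero_iff K, mem_lemma16VanishingIdeal_iff]

end Link

/-! ### §4. Soundness and completeness of the two tests, at the level of guessed blocks -/

section Tests

variable (K : Type u) [Field K] {n m c r : ℕ}

variable [CharZero K]

/-- **SOUNDNESS of the two tests.** If the chart-test circuit of a guessed block computes `0` and its
evaluation circuit at the instance entries does not, then the instance tensor has border completion
rank `> r`: the guessed polynomial vanishes on the image of `g`, hence ("since `p` is a polynomial")
on every tensor of border completion rank `≤ r` (Obs. 17, every slice of an `n × n` tensor having
rank `≤ n`), but not at the instance tensor. [cite: BlaserIkenmeyerJindalLysikov2018, Thm. 4 (proof: "The correctness follows from the construction") and Lemma 16] -/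
theorem lt_borderCompletionRank_of_testsC (l : List ℤ) (B : KBlock)
    (hrank : ∀ k, (slicesOfList K n m l k).rank ≤ c)
    (hchart : (chartCircuitC n m c r B).eval = 0)
    (heval : (evalCircuit (nPos n m) (entryFn l) B).eval ≠ 0) :
    r < borderCompletionRank (slice₀OfList K n l) (slicesOfList K n m l) := by
  haveI : Infinite K := Infinite.of_injective _ Nat.cast_injective
  have hmem := (eval_chartCircuitC_eq_zero_iff_mem (n := n) (m := m) (r := r) K B).1 hchart
  by_contra hle
  have hA : (slice₀OfList K n l, slicesOfList K n m l) ∈ bijlVariety K n m c r :=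
    ⟨le_of_not_gt hle, hrank⟩
  have h0 : eval (tensorPoint K (slice₀OfList K n l) (slicesOfList K n m l))
      (tensorPoly (n := n) (m := m) K B) = 0 :=
    eval_eq_zero_of_mem_bijlVariety (K := K) hA hmem
  rw [tensorPoly, ← cast_eval_blockPoly K l, Int.cast_eq_zero, ← eval_evalCircuit_eq_zero_iff] at h0
  exact heval h0

/-- **COMPLETENESS of the two tests.** A typed natural proof `IsBorderCRProof K A₀ A r s p` for the
instance tensor — "a polynomial that vanishes on all tensors of border completion rank `≤ r` but not
on `T_φ` and that has polynomial-size arithmetic circuits" (constant-free, fan-in two, size `≤ s`)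
— descends to a guessed block of length `≤ s + 1` whose references stay inside its use and which
passes both tests (the image of `g` consists of tensors of completion rank, hence border completion
rank, `≤ r`, Lemma 16). [cite: BlaserIkenmeyerJindalLysikov2018, Thm. 4 (proof: "Such a polynomial is guaranteed to exist by assumption") and Lemma 16] -/
theorem exists_block_of_isBorderCRProofC (l : List ℤ) {s : ℕ}
    {p : MvPolynomial (Option (Fin m) × Fin n × Fin n) K}
    (hp : IsBorderCRProof K (slice₀OfList K n l) (slicesOfList K n m l) r s p) :
    ∃ B : KBlock, B.length ≤ s + 1 ∧
      (∀ g ∈ B, g.a.idx < nPos n m + B.length ∧ g.b.idx < nPos n m + B.length) ∧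
      (chartCircuitC n m c r B).eval = 0 ∧
      (evalCircuit (nPos n m) (entryFn l) B).eval ≠ 0 := by
  haveI : Infinite K := Infinite.of_injective _ Nat.cast_injective
  obtain ⟨hne, hvan, P₀, h2, hs, hcomp, hsize⟩ := hp
  set e := posEquiv n m with he
  obtain ⟨B, hlen, hidx, hmap⟩ := exists_kblock_of_circuit (P₀.rename e) (h2.rename _) (hs.rename _)
  have hQ : map (Int.castRingHom K) (blockPoly (nPos n m) B) = rename e p := by
    rw [hmap, eval_rename_apply, hcomp]
  have hPp : tensorPoly (n := n) (m := m) K B = p := by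
    rw [tensorPoly, hQ, rename_rename, he, Equiv.symm_comp_self, rename_id_apply]
  refine ⟨B, by rw [hlen, size_rename]; omega, hidx, ?_, ?_⟩
  · refine (eval_chartCircuitC_eq_zero_iff_mem (n := n) (m := m) (r := r) K B).2 ?_
    rw [hPp]
    intro U₀ V₀ U V z
    exact hvan _ _ (lemma16Map_mem_bijlVariety (K := K) U₀ V₀ U V z).1
  · intro h0
    rw [eval_evalCircuit_eq_zero_iff] at h0
    apply hne
    rw [← hPp, tensorPoly, ← cast_eval_blockPoly K l, h0, Int.cast_zero]

end Tests


/-! ### §6. Any characteristic: the two tests read modulo the characteristic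

Appended by val-lit p7 g7 for the positive-characteristic half of Thm 4 (t21 g9's identity test
modulo a fixed prime): over a field `K` of characteristic `p` the chart test is the integer identity
`chartCircuitC ≡ 0` READ MODULO `p` and the evaluation test is the integer value read modulo `p`; the
block-level soundness / completeness of §4 hold over every INFINITE field in this form. -/

section AnyChar

open Literature.Computability.Complexity BIJL18NPHard
open CNF

variable (K : Type u) [Field K] {n m c r : ℕ}

/-- **The chart test over `K`**: the chart-test identity read over `K` holds iff `p ∘ g = 0` over `K`
(no assumption on the characteristic). [cite: BlaserIkenmeyerJindalLysikov2018, Thm. 4 (proof, step (2))] -/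
theorem map_eval_chartCircuitC_eq_zero_iff (B : KBlock) :
    map (Int.castRingHom K) (chartCircuitC n m c r B).eval = 0 ↔
      bind₁ (lemma16Poly K n m c r) (tensorPoly (n := n) (m := m) K B) = 0 := by
  rw [map_eval_chartCircuitC]
  constructor
  · intro h
    exact rename_injective _ (layoutEquivC n m c r).injective (by rw [h, map_zero])
  · intro h
    rw [h, map_zero]

/-- The chart test over an infinite `K` holds iff the guessed polynomial vanishes on the image of `g`.
[cite: BlaserIkenmeyerJindalLysikov2018, Lemma 16 and Obs. 17] -/
theorem map_eval_chartCircuitC_eq_zero_iff_mem [Infinite K] (B : KBlock) :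
    map (Int.castRingHom K) (chartCircuitC n m c r B).eval = 0 ↔
      tensorPoly (n := n) (m := m) K B ∈ lemma16VanishingIdeal K n m c r := by
  rw [map_eval_chartCircuitC_eq_zero_iff K, mem_lemma16VanishingIdeal_iff]

/-- **SOUNDNESS over any infinite field**: if the chart-test identity holds over `K` and the integer
value of the evaluation test is nonzero in `K`, the instance tensor has border completion rank `> r`.
[cite: BlaserIkenmeyerJindalLysikov2018, Thm. 4 (proof) and Lemma 16] -/
theorem lt_borderCompletionRank_of_testsC_map [Infinite K] (l : List ℤ) (B : KBlock)
    (hrank : ∀ k, (slicesOfList K n m l k).rank ≤ c)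
    (hchart : map (Int.castRingHom K) (chartCircuitC n m c r B).eval = 0)
    (heval : ((eval (fun i : Fin (nPos n m) => entryFn l i.1) (blockPoly (nPos n m) B) : ℤ) : K) ≠ 0) :
    r < borderCompletionRank (slice₀OfList K n l) (slicesOfList K n m l) := by
  have hmem := (map_eval_chartCircuitC_eq_zero_iff_mem (n := n) (m := m) (r := r) K B).1 hchart
  by_contra hle
  have hA : (slice₀OfList K n l, slicesOfList K n m l) ∈ bijlVariety K n m c r :=
    ⟨le_of_not_gt hle, hrank⟩
  have h0 : eval (tensorPoint K (slice₀OfList K n l) (slicesOfList K n m l))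
      (tensorPoly (n := n) (m := m) K B) = 0 :=
    eval_eq_zero_of_mem_bijlVariety (K := K) hA hmem
  rw [tensorPoly, ← cast_eval_blockPoly K l] at h0
  exact heval h0

/-- **COMPLETENESS over any infinite field**: a typed natural proof of the instance tensor descends to
a guessed block of length `≤ s + 1` whose chart-test identity holds over `K` and whose evaluation
value is nonzero in `K`. [cite: BlaserIkenmeyerJindalLysikov2018, Thm. 4 (proof) and Lemma 16] -/
theorem exists_block_of_isBorderCRProofC_map [Infinite K] (l : List ℤ) {s : ℕ}
    {p : MvPolynomial (Option (Fin m) × Fin n × Fin n) K}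
    (hp : IsBorderCRProof K (slice₀OfList K n l) (slicesOfList K n m l) r s p) :
    ∃ B : KBlock, B.length ≤ s + 1 ∧
      (∀ g ∈ B, g.a.idx < nPos n m + B.length ∧ g.b.idx < nPos n m + B.length) ∧
      map (Int.castRingHom K) (chartCircuitC n m c r B).eval = 0 ∧
      ((eval (fun i : Fin (nPos n m) => entryFn l i.1) (blockPoly (nPos n m) B) : ℤ) : K) ≠ 0 := by
  obtain ⟨hne, hvan, P₀, h2, hs, hcomp, hsize⟩ := hp
  set e := posEquiv n m with he
  obtain ⟨B, hlen, hidx, hmap⟩ := exists_kblock_of_circuit (P₀.rename e) (h2.rename _) (hs.rename _)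
  have hQ : map (Int.castRingHom K) (blockPoly (nPos n m) B) = rename e p := by
    rw [hmap, eval_rename_apply, hcomp]
  have hPp : tensorPoly (n := n) (m := m) K B = p := by
    rw [tensorPoly, hQ, rename_rename, he, Equiv.symm_comp_self, rename_id_apply]
  refine ⟨B, by rw [hlen, size_rename]; omega, hidx, ?_, ?_⟩
  · refine (map_eval_chartCircuitC_eq_zero_iff_mem (n := n) (m := m) (r := r) K B).2 ?_
    rw [hPp]
    intro U₀ V₀ U V z
    exact hvan _ _ (lemma16Map_mem_bijlVariety (K := K) U₀ V₀ U V z).1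
  · intro h0
    apply hne
    rw [← hPp, tensorPoly, ← cast_eval_blockPoly K l, h0]


/-- **COMPLETENESS FROM A SET OF EQUATIONS (any infinite field).** If `S` is a set of equations
cutting out `C^{n,m,c}_r` exactly, every member of which has a fan-in-two constant-free circuit of
size `≤ s` (the negation of the strengthened statement's conclusion at this `n`), and the instance
tensor is NOT in `C^{n,m,c}_r`, then some guessed block of length `≤ s + 1` passes both tests over
`K`: an equation `q ∈ S` not vanishing at the tensor exists, and `q` vanishes on `C^{n,m,c}_r ⊇ im g`.
[cite: BlaserIkenmeyerJindalLysikov2018, §3 remark after Obs. 17 ("for every set of equations describing the variety … at least one equation has superpolynomial circuit complexity")] -/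
theorem exists_block_of_equationsC [Infinite K] (l : List ℤ) {s : ℕ}
    {S : Set (MvPolynomial (Option (Fin m) × Fin n × Fin n) K)}
    (hS : {A | ∀ q ∈ S, eval (tensorPoint K A.1 A.2) q = 0} = bijlVariety K n m c r)
    (hEasy : ∀ q ∈ S, ∃ P : ArithCircuit K (Option (Fin m) × Fin n × Fin n),
      P.IsFanInTwo ∧ P.HasSignConstants ∧ P.Computes q ∧ P.size ≤ s)
    (hT : (slice₀OfList K n l, slicesOfList K n m l) ∉ bijlVariety K n m c r) :
    ∃ B : KBlock, B.length ≤ s + 1 ∧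
      (∀ g ∈ B, g.a.idx < nPos n m + B.length ∧ g.b.idx < nPos n m + B.length) ∧
      map (Int.castRingHom K) (chartCircuitC n m c r B).eval = 0 ∧
      ((eval (fun i : Fin (nPos n m) => entryFn l i.1) (blockPoly (nPos n m) B) : ℤ) : K) ≠ 0 := by
  -- an equation of `S` not vanishing at the instance tensor
  have hq : ∃ q ∈ S, eval (tensorPoint K (slice₀OfList K n l) (slicesOfList K n m l)) q ≠ 0 := by
    by_contra hall
    push Not at hall
    apply hT
    rw [← hS]
    exact hall
  obtain ⟨q, hqS, hne⟩ := hq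
  -- `q` vanishes on the variety, hence on the image of `g`
  have hvan : ∀ A ∈ bijlVariety K n m c r, eval (tensorPoint K A.1 A.2) q = 0 := fun A hA => by
    rw [← hS] at hA
    exact hA q hqS
  obtain ⟨P₀, h2, hs, hcomp, hsize⟩ := hEasy q hqS
  set e := posEquiv n m with he
  obtain ⟨B, hlen, hidx, hmap⟩ := exists_kblock_of_circuit (P₀.rename e) (h2.rename _) (hs.rename _)
  have hQ : map (Int.castRingHom K) (blockPoly (nPos n m) B) = rename e q := by
    rw [hmap, eval_rename_apply, hcomp]
  have hPq : tensorPoly (n := n) (m := m) K B = q := by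
    rw [tensorPoly, hQ, rename_rename, he, Equiv.symm_comp_self, rename_id_apply]
  refine ⟨B, by rw [hlen, size_rename]; omega, hidx, ?_, ?_⟩
  · refine (map_eval_chartCircuitC_eq_zero_iff_mem (n := n) (m := m) (c := c) (r := r) K B).2 ?_
    rw [hPq]
    intro U₀ V₀ U V z
    exact hvan _ (lemma16Map_mem_bijlVariety (K := K) U₀ V₀ U V z)
  · intro h0
    apply hne
    rw [← hPq, tensorPoly, ← cast_eval_blockPoly K l, h0]

variable (p : ℕ) [CharP K p]

variable [Infinite K]

/-- **SOUNDNESS in characteristic `p`**: the chart-test identity modulo `p` and a nonzero evaluation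
value modulo `p` force border completion rank `> r` of the instance tensor over `K`.
[cite: BlaserIkenmeyerJindalLysikov2018, Thm. 4 (proof) and Lemma 16] -/
theorem lt_borderCompletionRank_of_testsC_zmod (l : List ℤ) (B : KBlock)
    (hrank : ∀ k, (slicesOfList K n m l k).rank ≤ c)
    (hchart : map (Int.castRingHom (ZMod p)) (chartCircuitC n m c r B).eval = 0)
    (heval : ((eval (fun i : Fin (nPos n m) => entryFn l i.1) (blockPoly (nPos n m) B) : ℤ) : ZMod p) ≠ 0) :
    r < borderCompletionRank (slice₀OfList K n l) (slicesOfList K n m l) :=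
  lt_borderCompletionRank_of_testsC_map K l B hrank ((map_intCast_eq_zero_iff_zmod K p _).2 hchart)
    ((intCast_ne_zero_iff_zmod K p _).2 heval)

/-- **COMPLETENESS in characteristic `p`**: a typed natural proof over `K` descends to a guessed block
passing the chart test modulo `p` and the evaluation test modulo `p`.
[cite: BlaserIkenmeyerJindalLysikov2018, Thm. 4 (proof) and Lemma 16] -/
theorem exists_block_of_isBorderCRProofC_zmod (l : List ℤ) {s : ℕ}
    {q : MvPolynomial (Option (Fin m) × Fin n × Fin n) K}
    (hq : IsBorderCRProof K (slice₀OfList K n l) (slicesOfList K n m l) r s q) :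
    ∃ B : KBlock, B.length ≤ s + 1 ∧
      (∀ g ∈ B, g.a.idx < nPos n m + B.length ∧ g.b.idx < nPos n m + B.length) ∧
      map (Int.castRingHom (ZMod p)) (chartCircuitC n m c r B).eval = 0 ∧
      ((eval (fun i : Fin (nPos n m) => entryFn l i.1) (blockPoly (nPos n m) B) : ℤ) : ZMod p) ≠ 0 := by
  obtain ⟨B, hlen, hidx, hchart, heval⟩ := exists_block_of_isBorderCRProofC_map K l hq
  exact ⟨B, hlen, hidx, (map_intCast_eq_zero_iff_zmod K p _).1 hchart, (intCast_ne_zero_iff_zmod K p _).1 heval⟩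

end AnyChar




/-! ### §6. The slice ranks of the Thm-3 tensors (the constant `c` of Obs. 17) -/

section SliceRank

open Literature.Computability.Complexity BIJL18NPHard

variable (K : Type u) [Field K]

/-- **The slice `A_k` of the §3 tensor is diagonal and its rank is the number of literal positions
on the variable `x_k`** (bounded by that count; over a bounded-occurrence source it is the printed
constant `c`, "rk(A_i) ≤ c for all i for some constant c", Obs. 17).
[cite: BlaserIkenmeyerJindalLysikov2018, Obs. 17] -/
theorem rank_bijlSlices_le {t : ℕ} (φ : List (Literal (Fin t) × Literal (Fin t))) (k : Fin t) :
    (bijlSlices K φ k).rank ≤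
      (Finset.univ.filter fun p : Fin φ.length × Fin 2 => (clauseLit φ p.1 p.2).1 = k).card := by
  classical
  have hdiag : bijlSlices K φ k = Matrix.diagonal fun p => litCoeff K (clauseLit φ p.1 p.2) k := by
    ext p q
    simp [bijlSlices, Matrix.diagonal]
  rw [hdiag, Matrix.rank_diagonal, Fintype.card_subtype]
  refine Finset.card_le_card fun p hp => ?_
  simp only [Finset.mem_filter, Finset.mem_univ, true_and] at hp ⊢
  by_contra h
  exact hp (by simp [litCoeff, h])

/-- **The slice ranks of the coded tensor `T_φ` of a 2-CNF** are bounded by the number of literal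
positions carrying the renamed variable. [cite: BlaserIkenmeyerJindalLysikov2018, Obs. 17] -/
theorem rank_slicesOfList_entries_le (φ : CNF ℕ) (k : Fin (tOf φ)) :
    (slicesOfList K (nOf φ) (tOf φ) (entries φ) k).rank ≤
      (Finset.univ.filter fun p : Fin (pairsFin φ).length × Fin 2 => (clauseLit (pairsFin φ) p.1 p.2).1 = k).card := by
  rw [slicesOfList_entries, Matrix.rank_reindex]
  exact rank_bijlSlices_le K (pairsFin φ) k

end SliceRank

end BIJL2018Thm4

end Literature.Barriers.ValiantsHypothesis
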